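import Summits.CriticalPhenomena.SAWScalingLimit.Theorems.SAWTotalPositivityBoundaryTP2Defs
import Summits.CriticalPhenomena.SAWScalingLimit.Theorems.SAWTotalPositivityBoundaryTP2Kernel
import Summits.CriticalPhenomena.SAWScalingLimit.Theorems.SAWTotalPositivityBoundaryTP2Symmetry
import Summits.CriticalPhenomena.SAWScalingLimit.Theorems.SAWTotalPositivityBoundaryTP2FirstStep
import Summits.CriticalPhenomena.SAWScalingLimit.Theorems.SAWTotalPositivityBoundaryTP2Avoid
import Summits.CriticalPhenomena.SAWScalingLimit.Theorems.SAWTotalPositivityBoundaryTP2SquareGadget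
import Summits.CriticalPhenomena.SAWScalingLimit.Theorems.SAWTotalPositivityBoundaryTP2StarArms
import Summits.CriticalPhenomena.SAWScalingLimit.Theorems.SAWTotalPositivityBoundaryTP2Strip3RecCornerAux
import Summits.CriticalPhenomena.SAWScalingLimit.Theorems.SAWTotalPositivityBoundaryTP2Strip4RecCornerAux
import Summits.CriticalPhenomena.SAWScalingLimit.Theorems.EdgeOfPositivity.Negative.EdgeOfPositivityRectDomain
import HarnessLib

/-!
# Crux `BoundaryTP2` (stmt-CriticalPhenomena-7115), line `Sketch`: width-4 last-column recursion into
a corner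

Tool stub `stub_strip4_recCorner` (W4-C1) of the line's skeleton: the main identity of the 12-state
transfer of the 4-row strips `S_L = discreteDomainGraph (rectDomain L 3) 1` (sites `{0..L} × {0..3}`,
lattice adjacency). For the fugacity-`x` self-avoiding path kernel `Z` from `a = (0,r)` into the corner
`t = (L+1,ρ₀)` of `S_{L+1}` (row labelling `ρ = (ρ₀,ρ₁,ρ₂,ρ₃) ∈ {(0,1,2,3), (3,2,1,0)}`, `p_j = (L,ρ_j)`,
new sites `m_j = (L+1,ρ_j)`, disjoint-pair kernels `PP(s; u → v) = Σ x^{|γ|+|γ'|}` over vertex-disjoint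
self-avoiding `γ : a → p_s`, `γ' : p_u → p_v` of `S_L`):

  `Z_{S_{L+1}}(a,t) = x Z(a,p₀) + x² Z(a,p₁) + x³ Z(a,p₂) + x⁴ Z(a,p₃)`
  `    + x⁴ PP(2; 0→1) + x⁵ PP(3; 0→1) + x⁴ PP(3; 0→2) + x⁵ PP(3; 1→2)`.

Proof (`s4c_corner_abstract`, abstract comb `m₁ m₂ m₃` hung on `p₁ p₂ p₃`, corner `t ∼ p₀, m₁`):
first step at the degree-two corner `t` (`pathKernel_firstStep_pair`).
* From `m₁`: to `p₁` — then `{m₂, m₃}` is a hanging domino on `p₂, p₃`, unused (`x² Z(a,p₁)`) or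
  traversed as `p₃ m₃ m₂ p₂` (`x⁵ PP(3; 1→2)`, `s3dom_pathKernelOn_visit`, the other orientation
  excluded by interlacing) — or to `m₂`, then to `p₂` (`x³ Z(a,p₂)`) or via `m₃` to `p₃` (`x⁴ Z(a,p₃)`).
* From `p₀`: the paths avoiding `m₂` are paths of `S_L` (`m₁`, `m₃` become leaves): `x Z(a,p₀)`; the
  paths through `m₂` are two-arm stars at `m₂` (`pathKernelOn_visit_eq_tsum_arms`), nine pairs of arm
  ends in `{p₂, m₁, m₃}`; peeling the pendant edges `m₁ p₁`, `m₃ p₃` (`s4c_pair_leaf_end/start/irrel`)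
  leaves disjoint pairs of `S_L`: `(p₂,m₁)`, `(m₃,p₂)`, `(m₃,m₁)` give `x⁴ PP(2; 0→1)`, `x⁴ PP(3; 0→2)`,
  `x⁵ PP(3; 0→1)`; `(m₁,p₂)`, `(p₂,m₃)`, `(m₁,m₃)` are killed by interlacing; the diagonal ones vanish.
The strip instance is coordinate bookkeeping on `Site 2` closed by `omega`.
-/

noncomputable section

namespace Summit.CriticalPhenomena.SAWScalingLimit.Theorems.BoundaryTP2

open Literature.Probability.LatticeModels Literature.Probability.RandomPlanarGeometry
open Summit.CriticalPhenomena.SAWScalingLimit.Theorems.EdgeOfPositivity.Negative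
open scoped ENNReal

variable {V : Type*}

/-! ## The corner recursion for an abstract hanging comb -/

open Classical in
/-- **The corner recursion, abstract form.** `G'` is a graph in which the corner `t` has the
neighbours `p₀, m₁`; in `H = G' - t` the comb `m₁ m₂ m₃` hangs on `p₁, p₂, p₃` (`N(m₁) = {p₁, m₂}`,
`N(m₂) = {p₂, m₁, m₃}`, `N(m₃) = {m₂, p₃}`), and `G` is `G'` with `t, m₁, m₂, m₃` deleted. Under the
four interlacing hypotheses of `G`, `Z_{G'}(a,t)` is the eight-term combination of kernels and
disjoint-pair kernels of `G` of the module docstring. [folklore] -/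
theorem s4c_corner_abstract [DecidableEq V] (G' G : SimpleGraph V) (x : ℝ) (hx : 0 ≤ x)
    {a t p0 p1 p2 p3 m₁ m₂ m₃ : V} (hNt : G'.neighborSet t = {p0, m₁})
    (hN1 : (G'.deleteEdges (G'.incidenceSet t)).neighborSet m₁ = {p1, m₂})
    (hN2 : (G'.deleteEdges (G'.incidenceSet t)).neighborSet m₂ = {p2, m₁, m₃})
    (hN3 : ∀ z, (G'.deleteEdges (G'.incidenceSet t)).Adj m₃ z ↔ z = m₂ ∨ z = p3)
    (hG : ∀ u v, G.Adj u v ↔ G'.Adj u v ∧ (u ≠ t ∧ u ≠ m₁ ∧ u ≠ m₂ ∧ u ≠ m₃) ∧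
      (v ≠ t ∧ v ≠ m₁ ∧ v ≠ m₂ ∧ v ≠ m₃))
    (ha : a ≠ t ∧ a ≠ m₁ ∧ a ≠ m₂ ∧ a ≠ m₃) (hp0 : p0 ≠ m₁ ∧ p0 ≠ m₂ ∧ p0 ≠ m₃)
    (hp1 : p1 ≠ m₁ ∧ p1 ≠ m₂ ∧ p1 ≠ m₃) (hp2 : p2 ≠ m₁ ∧ p2 ≠ m₂ ∧ p2 ≠ m₃)
    (hp3 : p3 ≠ m₁ ∧ p3 ≠ m₂ ∧ p3 ≠ m₃) (hm : m₁ ≠ m₂ ∧ m₁ ≠ m₃ ∧ m₂ ≠ m₃)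
    (hI1 : Interlaced G a p0 p1 p2) (hI2 : Interlaced G a p0 p1 p3)
    (hI3 : Interlaced G a p0 p2 p3) (hI4 : Interlaced G a p1 p2 p3) :
    pathKernel G' x a t =
      ENNReal.ofReal x * pathKernel G x a p0 + ENNReal.ofReal (x ^ 2) * pathKernel G x a p1 +
        ENNReal.ofReal (x ^ 3) * pathKernel G x a p2 + ENNReal.ofReal (x ^ 4) * pathKernel G x a p3 +
        ENNReal.ofReal (x ^ 4) *
          (∑' (γ : G.Path a p2) (γ' : G.Path p0 p1),
            (if List.Disjoint γ.1.support γ'.1.support then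
              ENNReal.ofReal (x ^ γ.1.length) * ENNReal.ofReal (x ^ γ'.1.length) else 0)) +
        ENNReal.ofReal (x ^ 5) *
          (∑' (γ : G.Path a p3) (γ' : G.Path p0 p1),
            (if List.Disjoint γ.1.support γ'.1.support then
              ENNReal.ofReal (x ^ γ.1.length) * ENNReal.ofReal (x ^ γ'.1.length) else 0)) +
        ENNReal.ofReal (x ^ 4) *
          (∑' (γ : G.Path a p3) (γ' : G.Path p0 p2),
            (if List.Disjoint γ.1.support γ'.1.support then
              ENNReal.ofReal (x ^ γ.1.length) * ENNReal.ofReal (x ^ γ'.1.length) else 0)) +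
        ENNReal.ofReal (x ^ 5) *
          (∑' (γ : G.Path a p3) (γ' : G.Path p1 p2),
            (if List.Disjoint γ.1.support γ'.1.support then
              ENNReal.ofReal (x ^ γ.1.length) * ENNReal.ofReal (x ^ γ'.1.length) else 0)) := by
  obtain ⟨hat, ham₁, ham₂, ham₃⟩ := ha
  obtain ⟨hp0m₁, hp0m₂, hp0m₃⟩ := hp0
  -- first step at the corner `t`
  rw [pathKernel_comm G' x a t, pathKernel_firstStep_pair G' x hx hat.symm hp0m₁ hNt]
  set H := G'.deleteEdges (G'.incidenceSet t) with hH
  have hA1 : ∀ z, H.Adj m₁ z ↔ z = p1 ∨ z = m₂ := fun z => by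
    rw [← SimpleGraph.mem_neighborSet, hN1, Set.mem_insert_iff, Set.mem_singleton_iff]
  have hA2 : ∀ z, H.Adj m₂ z ↔ z = p2 ∨ z = m₁ ∨ z = m₃ := fun z => by
    rw [← SimpleGraph.mem_neighborSet, hN2, Set.mem_insert_iff, Set.mem_insert_iff,
      Set.mem_singleton_iff]
  /- the `m₁`-branch: first step at `m₁` -/
  rw [pathKernel_firstStep_pair H x hx ham₁.symm hp1.2.1 hN1]
  set K₁ := H.deleteEdges (H.incidenceSet m₁) with hK₁
  have hNm : ∀ z, K₁.Adj m₂ z ↔ z = p2 ∨ z = m₃ := fun z => by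
    rw [hK₁, deleteEdges_incidenceSet_adj, hA2 z]
    constructor
    · rintro ⟨h | h | h, -, hz⟩
      exacts [Or.inl h, (hz h).elim, Or.inr h]
    · rintro (rfl | rfl)
      exacts [⟨Or.inl rfl, hm.1.symm, hp2.1⟩, ⟨Or.inr (Or.inr rfl), hm.1.symm, hm.2.1.symm⟩]
  have hNn : ∀ z, K₁.Adj m₃ z ↔ z = m₂ ∨ z = p3 := fun z => by
    rw [hK₁, deleteEdges_incidenceSet_adj, hN3 z]
    constructor
    · rintro ⟨h, -, -⟩
      exact h
    · rintro (rfl | rfl)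
      exacts [⟨Or.inl rfl, hm.2.1.symm, hm.1.symm⟩, ⟨Or.inr rfl, hm.2.1.symm, hp3.1⟩]
  have hNK₁ : K₁.neighborSet m₂ = {p2, m₃} := by
    ext z
    rw [SimpleGraph.mem_neighborSet, hNm z, Set.mem_insert_iff, Set.mem_singleton_iff]
  -- from `m₂`: to `p2` (then `m₃` is a leaf) or through `m₃` to `p3`
  rw [pathKernel_firstStep_pair K₁ x hx ham₂.symm hp2.2.2 hNK₁]
  set K₁₂ := K₁.deleteEdges (K₁.incidenceSet m₂) with hK₁₂
  have hleaf₁₂ : ∀ z, K₁₂.Adj m₃ z → z = p3 := fun z hz => by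
    rw [hK₁₂, deleteEdges_incidenceSet_adj, hNn z] at hz
    rcases hz with ⟨h | h, -, hz⟩
    exacts [(hz h).elim, h]
  have hNK₁₂ : K₁₂.neighborSet m₃ = {p3} := by
    ext z
    rw [SimpleGraph.mem_neighborSet, Set.mem_singleton_iff]
    refine ⟨hleaf₁₂ z, ?_⟩
    rintro rfl
    rw [hK₁₂, deleteEdges_incidenceSet_adj, hNn]
    exact ⟨Or.inr rfl, hm.2.2.symm, hp3.2.1⟩
  have hE3 : K₁₂.deleteEdges (K₁₂.incidenceSet m₃) = G := s4c_delete_four G' G t m₁ m₂ m₃ hG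
  rw [pathKernel_eq_deleteVert_of_leaf K₁₂ x hleaf₁₂ hp2.2.2 ham₃,
    pathKernel_firstStep_single K₁₂ x hx ham₃.symm hNK₁₂, hE3, pathKernel_comm G x p2 a,
    pathKernel_comm G x p3 a]
  -- from `p1`: the hanging domino `{m₂, m₃}`
  have hR₁ : ∀ u v, G.Adj u v ↔ K₁.Adj u v ∧ (u ≠ m₂ ∧ u ≠ m₃) ∧ (v ≠ m₂ ∧ v ≠ m₃) := by
    intro u v
    rw [← hE3, deleteEdges_incidenceSet_adj, hK₁₂, deleteEdges_incidenceSet_adj]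
    tauto
  have hc₁ : {γ : K₁.Path a p1 | m₂ ∉ γ.1.support}ᶜ = {γ | m₂ ∈ γ.1.support} := by
    rw [Set.compl_setOf]; simp only [not_not]
  rw [pathKernel_comm K₁ x p1 a, ← pathKernelOn_add_compl x a p1 {γ : K₁.Path a p1 | m₂ ∉ γ.1.support},
    stub_pathKernelOn_avoid K₁ x a p1 m₂ ham₂ hp1.2.1, ← hK₁₂,
    pathKernel_eq_deleteVert_of_leaf K₁₂ x hleaf₁₂ ham₃ hp1.2.2, hE3, hc₁,
    s3dom_pathKernelOn_visit K₁ G x hx hR₁ hNm hNn ham₂ ham₃ hp1.2.1 hp1.2.2 hp2.2.2 hI4.reverse_right,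
    s4c_pair_reverse_right G x a p3 p2 p1]
  /- the `p0`-branch: paths avoiding `m₂` (then `m₁`, `m₃` are leaves) -/
  have hc₂ : {γ : H.Path a p0 | m₂ ∉ γ.1.support}ᶜ = {γ | m₂ ∈ γ.1.support} := by
    rw [Set.compl_setOf]; simp only [not_not]
  rw [pathKernel_comm H x p0 a, ← pathKernelOn_add_compl x a p0 {γ : H.Path a p0 | m₂ ∉ γ.1.support},
    stub_pathKernelOn_avoid H x a p0 m₂ ham₂ hp0m₂]
  set K₂ := H.deleteEdges (H.incidenceSet m₂) with hK₂
  have hleaf₂₁ : ∀ z, K₂.Adj m₁ z → z = p1 := fun z hz => by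
    rw [hK₂, deleteEdges_incidenceSet_adj, hA1 z] at hz
    rcases hz with ⟨h | h, -, hz⟩
    exacts [h, (hz h).elim]
  have hleaf₂₃ : ∀ z, K₂.Adj m₃ z → z = p3 := fun z hz => by
    rw [hK₂, deleteEdges_incidenceSet_adj, hN3 z] at hz
    rcases hz with ⟨h | h, -, hz⟩
    exacts [(hz h).elim, h]
  have hadj₂₁ : K₂.Adj m₁ p1 := by
    rw [hK₂, deleteEdges_incidenceSet_adj, hA1]; exact ⟨Or.inl rfl, hm.1, hp1.2.1⟩
  have hadj₂₃ : K₂.Adj m₃ p3 := by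
    rw [hK₂, deleteEdges_incidenceSet_adj, hN3]; exact ⟨Or.inr rfl, hm.2.2.symm, hp3.2.1⟩
  rw [pathKernel_eq_deleteVert_of_leaf K₂ x hleaf₂₁ ham₁ hp0m₁]
  set K₂₁ := K₂.deleteEdges (K₂.incidenceSet m₁) with hK₂₁
  have hleaf₂₁₃ : ∀ z, K₂₁.Adj m₃ z → z = p3 := fun z hz =>
    hleaf₂₃ z (by rw [hK₂₁, deleteEdges_incidenceSet_adj] at hz; exact hz.1)
  have hadj₂₁₃ : K₂₁.Adj m₃ p3 := by
    rw [hK₂₁, deleteEdges_incidenceSet_adj]; exact ⟨hadj₂₃, hm.2.1.symm, hp3.1⟩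
  have hE1 : K₂₁.deleteEdges (K₂₁.incidenceSet m₃) = G :=
    s4c_delete_four G' G t m₂ m₁ m₃ fun u v => (hG u v).trans (by tauto)
  rw [pathKernel_eq_deleteVert_of_leaf K₂₁ x hleaf₂₁₃ ham₃ hp0m₃, hE1]
  set K₂₃ := K₂.deleteEdges (K₂.incidenceSet m₃) with hK₂₃
  have hleaf₂₃₁ : ∀ z, K₂₃.Adj m₁ z → z = p1 := fun z hz =>
    hleaf₂₁ z (by rw [hK₂₃, deleteEdges_incidenceSet_adj] at hz; exact hz.1)
  have hadj₂₃₁ : K₂₃.Adj m₁ p1 := by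
    rw [hK₂₃, deleteEdges_incidenceSet_adj]; exact ⟨hadj₂₁, hm.2.1, hp1.2.2⟩
  have hE2 : K₂₃.deleteEdges (K₂₃.incidenceSet m₁) = G :=
    s4c_delete_four G' G t m₂ m₃ m₁ fun u v => (hG u v).trans (by tauto)
  /- the `p0`-branch: paths through `m₂` are two-arm stars at `m₂` -/
  rw [hc₂, pathKernelOn_visit_eq_tsum_arms H x hx a p0 m₂ ham₂ hp0m₂, ← hK₂]
  obtain ⟨f, hf⟩ : ∃ f : V → V → ℝ≥0∞, ∀ u v, f u v = ∑' (α : K₂.Path a u) (β : K₂.Path v p0),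
      (if List.Disjoint α.1.support β.1.support then
        ENNReal.ofReal (x ^ α.1.length) * ENNReal.ofReal (x ^ β.1.length) else 0) :=
    ⟨_, fun _ _ => rfl⟩
  have hstar : (∑' (u : H.neighborSet m₂) (v : H.neighborSet m₂) (α : K₂.Path a u)
      (β : K₂.Path v p0), (if List.Disjoint α.1.support β.1.support then
        ENNReal.ofReal (x ^ α.1.length) * ENNReal.ofReal (x ^ β.1.length) else 0)) =
      (f p2 p2 + f p2 m₁ + f p2 m₃) + (f m₁ p2 + f m₁ m₁ + f m₁ m₃) +
        (f m₃ p2 + f m₃ m₁ + f m₃ m₃) := by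
    rw [← s4c_tsum_triple₂ f hp2.1 hp2.2.2 hm.2.1 hN2]
    simp only [hf]
  have h_pp : f p2 p2 = 0 := by rw [hf]; exact s4c_pair_diag K₂ x a p2 p0
  have h_11 : f m₁ m₁ = 0 := by rw [hf]; exact s4c_pair_diag K₂ x a m₁ p0
  have h_33 : f m₃ m₃ = 0 := by rw [hf]; exact s4c_pair_diag K₂ x a m₃ p0
  have h_p1 : f p2 m₁ = ENNReal.ofReal x * ∑' (γ : G.Path a p2) (γ' : G.Path p0 p1),
      (if List.Disjoint γ.1.support γ'.1.support then
        ENNReal.ofReal (x ^ γ.1.length) * ENNReal.ofReal (x ^ γ'.1.length) else 0) := by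
    rw [hf, s4c_pair_leaf_start K₂ K₂₁ x hx hK₂₁ hleaf₂₁ hadj₂₁ ham₁ hp2.1 hp0m₁,
      s4c_pair_leaf_irrel K₂₁ G x hE1.symm hleaf₂₁₃ ham₃ hp2.2.2 hp1.2.2 hp0m₃,
      s4c_pair_reverse_right G x a p2 p1 p0]
  have h_p3 : f p2 m₃ = 0 := by
    rw [hf, s4c_pair_leaf_start K₂ K₂₃ x hx hK₂₃ hleaf₂₃ hadj₂₃ ham₃ hp2.2.2 hp0m₃,
      s4c_pair_leaf_irrel K₂₃ G x hE2.symm hleaf₂₃₁ ham₁ hp2.1 hp3.1 hp0m₁,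
      s4c_pair_interlaced G x hI3.reverse_right, mul_zero]
  have h_1p : f m₁ p2 = 0 := by
    rw [hf, s4c_pair_leaf_end K₂ K₂₁ x hx hK₂₁ hleaf₂₁ hadj₂₁.symm ham₁ hp2.1 hp0m₁,
      s4c_pair_leaf_irrel K₂₁ G x hE1.symm hleaf₂₁₃ ham₃ hp1.2.2 hp2.2.2 hp0m₃,
      s4c_pair_interlaced G x hI1.reverse_right, mul_zero]
  have h_13 : f m₁ m₃ = 0 := by
    rw [hf, s4c_pair_leaf_end K₂ K₂₁ x hx hK₂₁ hleaf₂₁ hadj₂₁.symm ham₁ hm.2.1.symm hp0m₁,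
      s4c_pair_leaf_start K₂₁ G x hx hE1.symm hleaf₂₁₃ hadj₂₁₃ ham₃ hp1.2.2 hp0m₃,
      s4c_pair_interlaced G x hI2.reverse_right, mul_zero, mul_zero]
  have h_3p : f m₃ p2 = ENNReal.ofReal x * ∑' (γ : G.Path a p3) (γ' : G.Path p0 p2),
      (if List.Disjoint γ.1.support γ'.1.support then
        ENNReal.ofReal (x ^ γ.1.length) * ENNReal.ofReal (x ^ γ'.1.length) else 0) := by
    rw [hf, s4c_pair_leaf_end K₂ K₂₃ x hx hK₂₃ hleaf₂₃ hadj₂₃.symm ham₃ hp2.2.2 hp0m₃,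
      s4c_pair_leaf_irrel K₂₃ G x hE2.symm hleaf₂₃₁ ham₁ hp3.1 hp2.1 hp0m₁,
      s4c_pair_reverse_right G x a p3 p2 p0]
  have h_31 : f m₃ m₁ = ENNReal.ofReal x * (ENNReal.ofReal x *
      ∑' (γ : G.Path a p3) (γ' : G.Path p0 p1),
        (if List.Disjoint γ.1.support γ'.1.support then
          ENNReal.ofReal (x ^ γ.1.length) * ENNReal.ofReal (x ^ γ'.1.length) else 0)) := by
    rw [hf, s4c_pair_leaf_end K₂ K₂₃ x hx hK₂₃ hleaf₂₃ hadj₂₃.symm ham₃ hm.2.1 hp0m₃,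
      s4c_pair_leaf_start K₂₃ G x hx hE2.symm hleaf₂₃₁ hadj₂₃₁ ham₁ hp3.1 hp0m₁,
      s4c_pair_reverse_right G x a p3 p1 p0]
  rw [hstar, h_pp, h_p1, h_p3, h_11, h_1p, h_13, h_3p, h_31, h_33]
  -- bookkeeping
  simp only [ENNReal.ofReal_pow hx]
  ring

/-! ## Coordinates on the 4-row strip -/

/-- Adjacency in `ℤ²` in coordinates (after `…BoundaryTP2LadderKernels`). [folklore] -/
private theorem s4c_zd_adj_iff (u v : Site 2) :
    (zdGraph 2).Adj u v ↔
      ((v 0 = u 0 + 1 ∨ u 0 = v 0 + 1) ∧ v 1 = u 1) ∨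
        ((v 1 = u 1 + 1 ∨ u 1 = v 1 + 1) ∧ v 0 = u 0) := by
  rw [zdGraph_adj_iff, Fin.exists_fin_two]
  simp only [funext_iff, Fin.forall_fin_two, Pi.add_apply, Pi.single_eq_same,
    Pi.single_eq_of_ne (one_ne_zero : (1 : Fin 2) ≠ 0),
    Pi.single_eq_of_ne (zero_ne_one : (0 : Fin 2) ≠ 1), add_zero]
  omega

/-- A site equals `st a b` iff its two coordinates are `a` and `b`. [folklore] -/
private theorem s4c_eq_st_iff (v : Site 2) (a b : ℤ) : v = st a b ↔ v 0 = a ∧ v 1 = b :=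
  ⟨fun h => h ▸ ⟨rfl, rfl⟩, fun h => by rw [← st_eta v, h.1, h.2]⟩

/-- Adjacency of the 4-row strip `{0..a} × {0,1,2,3}` in coordinates. [folklore] -/
private theorem s4c_adj_iff (a : ℕ) (u v : Site 2) :
    (discreteDomainGraph (rectDomain a 3) 1).Adj u v ↔
      (((v 0 = u 0 + 1 ∨ u 0 = v 0 + 1) ∧ v 1 = u 1) ∨
          ((v 1 = u 1 + 1 ∨ u 1 = v 1 + 1) ∧ v 0 = u 0)) ∧
        ((0 ≤ u 0 ∧ u 0 ≤ a) ∧ (0 ≤ u 1 ∧ u 1 ≤ 3)) ∧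
          ((0 ≤ v 0 ∧ v 0 ≤ a) ∧ (0 ≤ v 1 ∧ v 1 ≤ 3)) := by
  rw [adj_rect_iff, s4c_zd_adj_iff, mem_rectSites_iff, mem_rectSites_iff, Nat.cast_ofNat]

/-! ## The last column of `S_{L+1}` -/

/-- The corner `(L+1,ρ₀)` of `S_{L+1}` has exactly the neighbours `(L,ρ₀)` and `(L+1,ρ₁)`. [folklore] -/
private theorem s4c_corner_neighborSet (L : ℕ) (r0 r1 r2 r3 : ℤ)
    (hρ : (r0 = 0 ∧ r1 = 1 ∧ r2 = 2 ∧ r3 = 3) ∨ (r0 = 3 ∧ r1 = 2 ∧ r2 = 1 ∧ r3 = 0)) :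
    (discreteDomainGraph (rectDomain (L + 1) 3) 1).neighborSet (st (L + 1 : ℕ) r0) =
      {st L r0, st (L + 1 : ℕ) r1} := by
  ext v
  rw [SimpleGraph.mem_neighborSet, s4c_adj_iff, Set.mem_insert_iff, Set.mem_singleton_iff]
  simp only [s4c_eq_st_iff, st_zero, st_one, Nat.cast_succ]
  omega

/-- In `S_{L+1} - t` the site `(L+1,ρ₁)` has exactly the neighbours `(L,ρ₁)` and `(L+1,ρ₂)`.
[folklore] -/
private theorem s4c_near_neighborSet (L : ℕ) (r0 r1 r2 r3 : ℤ)
    (hρ : (r0 = 0 ∧ r1 = 1 ∧ r2 = 2 ∧ r3 = 3) ∨ (r0 = 3 ∧ r1 = 2 ∧ r2 = 1 ∧ r3 = 0)) :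
    ((discreteDomainGraph (rectDomain (L + 1) 3) 1).deleteEdges
        ((discreteDomainGraph (rectDomain (L + 1) 3) 1).incidenceSet (st (L + 1 : ℕ) r0))).neighborSet
        (st (L + 1 : ℕ) r1) = {st L r1, st (L + 1 : ℕ) r2} := by
  ext v
  rw [SimpleGraph.mem_neighborSet, deleteEdges_incidenceSet_adj, s4c_adj_iff, Set.mem_insert_iff,
    Set.mem_singleton_iff]
  simp only [Ne, s4c_eq_st_iff, st_zero, st_one, Nat.cast_succ]
  omega

/-- In `S_{L+1} - t` the site `(L+1,ρ₂)` has exactly the neighbours `(L,ρ₂)`, `(L+1,ρ₁)`, `(L+1,ρ₃)`.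
[folklore] -/
private theorem s4c_mid_neighborSet (L : ℕ) (r0 r1 r2 r3 : ℤ)
    (hρ : (r0 = 0 ∧ r1 = 1 ∧ r2 = 2 ∧ r3 = 3) ∨ (r0 = 3 ∧ r1 = 2 ∧ r2 = 1 ∧ r3 = 0)) :
    ((discreteDomainGraph (rectDomain (L + 1) 3) 1).deleteEdges
        ((discreteDomainGraph (rectDomain (L + 1) 3) 1).incidenceSet (st (L + 1 : ℕ) r0))).neighborSet
        (st (L + 1 : ℕ) r2) = {st L r2, st (L + 1 : ℕ) r1, st (L + 1 : ℕ) r3} := by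
  ext v
  rw [SimpleGraph.mem_neighborSet, deleteEdges_incidenceSet_adj, s4c_adj_iff, Set.mem_insert_iff,
    Set.mem_insert_iff, Set.mem_singleton_iff]
  simp only [Ne, s4c_eq_st_iff, st_zero, st_one, Nat.cast_succ]
  omega

/-- In `S_{L+1} - t` the far corner `(L+1,ρ₃)` has exactly the neighbours `(L+1,ρ₂)` and `(L,ρ₃)`.
[folklore] -/
private theorem s4c_far_adj_iff (L : ℕ) (r0 r1 r2 r3 : ℤ)
    (hρ : (r0 = 0 ∧ r1 = 1 ∧ r2 = 2 ∧ r3 = 3) ∨ (r0 = 3 ∧ r1 = 2 ∧ r2 = 1 ∧ r3 = 0)) (z : Site 2) :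
    ((discreteDomainGraph (rectDomain (L + 1) 3) 1).deleteEdges
        ((discreteDomainGraph (rectDomain (L + 1) 3) 1).incidenceSet (st (L + 1 : ℕ) r0))).Adj
        (st (L + 1 : ℕ) r3) z ↔ z = st (L + 1 : ℕ) r2 ∨ z = st L r3 := by
  rw [deleteEdges_incidenceSet_adj, s4c_adj_iff]
  simp only [Ne, s4c_eq_st_iff, st_zero, st_one, Nat.cast_succ]
  omega

/-- The sites of `S_L` are the sites of `S_{L+1}` off the new column `L+1`. [folklore] -/
private theorem s4c_mem_old_iff (L : ℕ) (r0 r1 r2 r3 : ℤ)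
    (hρ : (r0 = 0 ∧ r1 = 1 ∧ r2 = 2 ∧ r3 = 3) ∨ (r0 = 3 ∧ r1 = 2 ∧ r2 = 1 ∧ r3 = 0)) (u : Site 2) :
    u ∈ rectSites L 3 ↔ u ∈ rectSites (L + 1) 3 ∧
      (u ≠ st (L + 1 : ℕ) r0 ∧ u ≠ st (L + 1 : ℕ) r1 ∧ u ≠ st (L + 1 : ℕ) r2 ∧ u ≠ st (L + 1 : ℕ) r3) := by
  rw [mem_rectSites_iff, mem_rectSites_iff, Ne, Ne, Ne, Ne, s4c_eq_st_iff, s4c_eq_st_iff, s4c_eq_st_iff,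
    s4c_eq_st_iff]
  omega

/-- `S_L` is `S_{L+1}` with the four sites of the last column deleted (adjacency form). [folklore] -/
private theorem s4c_old_adj_iff (L : ℕ) (r0 r1 r2 r3 : ℤ)
    (hρ : (r0 = 0 ∧ r1 = 1 ∧ r2 = 2 ∧ r3 = 3) ∨ (r0 = 3 ∧ r1 = 2 ∧ r2 = 1 ∧ r3 = 0)) (u v : Site 2) :
    (discreteDomainGraph (rectDomain L 3) 1).Adj u v ↔
      (discreteDomainGraph (rectDomain (L + 1) 3) 1).Adj u v ∧
        (u ≠ st (L + 1 : ℕ) r0 ∧ u ≠ st (L + 1 : ℕ) r1 ∧ u ≠ st (L + 1 : ℕ) r2 ∧ u ≠ st (L + 1 : ℕ) r3) ∧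
        (v ≠ st (L + 1 : ℕ) r0 ∧ v ≠ st (L + 1 : ℕ) r1 ∧ v ≠ st (L + 1 : ℕ) r2 ∧ v ≠ st (L + 1 : ℕ) r3) := by
  rw [adj_rect_iff, adj_rect_iff, s4c_mem_old_iff L r0 r1 r2 r3 hρ u, s4c_mem_old_iff L r0 r1 r2 r3 hρ v]
  tauto

/-- Distinctness of the sites involved: `a = (0,r)` and the `p_j = (L,ρ_j)` lie off the new column, whose
sites are distinct. [folklore] -/
private theorem s4c_distinct (L : ℕ) (r r0 r1 r2 r3 : ℤ)
    (hρ : (r0 = 0 ∧ r1 = 1 ∧ r2 = 2 ∧ r3 = 3) ∨ (r0 = 3 ∧ r1 = 2 ∧ r2 = 1 ∧ r3 = 0)) :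
    (st 0 r ≠ st (L + 1 : ℕ) r0 ∧ st 0 r ≠ st (L + 1 : ℕ) r1 ∧ st 0 r ≠ st (L + 1 : ℕ) r2 ∧
        st 0 r ≠ st (L + 1 : ℕ) r3) ∧
      (st (L : ℤ) r0 ≠ st (L + 1 : ℕ) r1 ∧ st (L : ℤ) r0 ≠ st (L + 1 : ℕ) r2 ∧
        st (L : ℤ) r0 ≠ st (L + 1 : ℕ) r3) ∧
      (st (L : ℤ) r1 ≠ st (L + 1 : ℕ) r1 ∧ st (L : ℤ) r1 ≠ st (L + 1 : ℕ) r2 ∧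
        st (L : ℤ) r1 ≠ st (L + 1 : ℕ) r3) ∧
      (st (L : ℤ) r2 ≠ st (L + 1 : ℕ) r1 ∧ st (L : ℤ) r2 ≠ st (L + 1 : ℕ) r2 ∧
        st (L : ℤ) r2 ≠ st (L + 1 : ℕ) r3) ∧
      (st (L : ℤ) r3 ≠ st (L + 1 : ℕ) r1 ∧ st (L : ℤ) r3 ≠ st (L + 1 : ℕ) r2 ∧
        st (L : ℤ) r3 ≠ st (L + 1 : ℕ) r3) ∧
      (st (L + 1 : ℕ) r1 ≠ st (L + 1 : ℕ) r2 ∧ st (L + 1 : ℕ) r1 ≠ st (L + 1 : ℕ) r3 ∧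
        st (L + 1 : ℕ) r2 ≠ st (L + 1 : ℕ) r3) := by
  refine ⟨⟨?_, ?_, ?_, ?_⟩, ⟨?_, ?_, ?_⟩, ⟨?_, ?_, ?_⟩, ⟨?_, ?_, ?_⟩, ⟨?_, ?_, ?_⟩, ⟨?_, ?_, ?_⟩⟩
  all_goals
    rw [Ne, s4c_eq_st_iff]
    dsimp only [st_zero, st_one]
    omega

/-! ## The recursion -/

open Classical in
/-- STUB W4-C1 (`stub_strip4_recCorner`). Width-4 last-column recursion for the kernel to a CORNER
`(L+1,ρ₀)` of the new column (both corners via the row labelling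
`ρ = (ρ₀,ρ₁,ρ₂,ρ₃) ∈ {(0,1,2,3),(3,2,1,0)}`): one crossing of the last cut (four terms) or three
crossings (four disjoint-pair terms); the four interlacing hypotheses kill the pair states whose main
endpoint lies between the loop's rows. See the module docstring and `s4c_corner_abstract`. [folklore] -/
theorem stub_strip4_recCorner (L : ℕ) {x : ℝ} (hx : 0 ≤ x) (r : ℤ) (hr : 0 ≤ r ∧ r ≤ 3) (r0 r1 r2 r3 : ℤ)
    (hρ : (r0 = 0 ∧ r1 = 1 ∧ r2 = 2 ∧ r3 = 3) ∨ (r0 = 3 ∧ r1 = 2 ∧ r2 = 1 ∧ r3 = 0))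
    (hI1 : Interlaced (discreteDomainGraph (rectDomain L 3) 1) (st 0 r) (st L r0) (st L r1) (st L r2))
    (hI2 : Interlaced (discreteDomainGraph (rectDomain L 3) 1) (st 0 r) (st L r0) (st L r1) (st L r3))
    (hI3 : Interlaced (discreteDomainGraph (rectDomain L 3) 1) (st 0 r) (st L r0) (st L r2) (st L r3))
    (hI4 : Interlaced (discreteDomainGraph (rectDomain L 3) 1) (st 0 r) (st L r1) (st L r2) (st L r3)) :
    pathKernel (discreteDomainGraph (rectDomain (L + 1) 3) 1) x (st 0 r) (st (L + 1 : ℕ) r0) =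
      ENNReal.ofReal x * pathKernel (discreteDomainGraph (rectDomain L 3) 1) x (st 0 r) (st L r0) +
        ENNReal.ofReal (x ^ 2) * pathKernel (discreteDomainGraph (rectDomain L 3) 1) x (st 0 r) (st L r1) +
        ENNReal.ofReal (x ^ 3) * pathKernel (discreteDomainGraph (rectDomain L 3) 1) x (st 0 r) (st L r2) +
        ENNReal.ofReal (x ^ 4) * pathKernel (discreteDomainGraph (rectDomain L 3) 1) x (st 0 r) (st L r3) +
        ENNReal.ofReal (x ^ 4) *
          (∑' (γ : (discreteDomainGraph (rectDomain L 3) 1).Path (st 0 r) (st L r2))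
              (γ' : (discreteDomainGraph (rectDomain L 3) 1).Path (st L r0) (st L r1)),
            (if List.Disjoint γ.1.support γ'.1.support then
              ENNReal.ofReal (x ^ γ.1.length) * ENNReal.ofReal (x ^ γ'.1.length) else 0)) +
        ENNReal.ofReal (x ^ 5) *
          (∑' (γ : (discreteDomainGraph (rectDomain L 3) 1).Path (st 0 r) (st L r3))
              (γ' : (discreteDomainGraph (rectDomain L 3) 1).Path (st L r0) (st L r1)),
            (if List.Disjoint γ.1.support γ'.1.support then
              ENNReal.ofReal (x ^ γ.1.length) * ENNReal.ofReal (x ^ γ'.1.length) else 0)) +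
        ENNReal.ofReal (x ^ 4) *
          (∑' (γ : (discreteDomainGraph (rectDomain L 3) 1).Path (st 0 r) (st L r3))
              (γ' : (discreteDomainGraph (rectDomain L 3) 1).Path (st L r0) (st L r2)),
            (if List.Disjoint γ.1.support γ'.1.support then
              ENNReal.ofReal (x ^ γ.1.length) * ENNReal.ofReal (x ^ γ'.1.length) else 0)) +
        ENNReal.ofReal (x ^ 5) *
          (∑' (γ : (discreteDomainGraph (rectDomain L 3) 1).Path (st 0 r) (st L r3))
              (γ' : (discreteDomainGraph (rectDomain L 3) 1).Path (st L r1) (st L r2)),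
            (if List.Disjoint γ.1.support γ'.1.support then
              ENNReal.ofReal (x ^ γ.1.length) * ENNReal.ofReal (x ^ γ'.1.length) else 0)) := by
  obtain ⟨-, -⟩ := hr
  obtain ⟨ha, hp0, hp1, hp2, hp3, hm⟩ := s4c_distinct L r r0 r1 r2 r3 hρ
  exact s4c_corner_abstract _ _ x hx (s4c_corner_neighborSet L r0 r1 r2 r3 hρ)
    (s4c_near_neighborSet L r0 r1 r2 r3 hρ) (s4c_mid_neighborSet L r0 r1 r2 r3 hρ)
    (s4c_far_adj_iff L r0 r1 r2 r3 hρ) (s4c_old_adj_iff L r0 r1 r2 r3 hρ) ha hp0 hp1 hp2 hp3 hm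
    hI1 hI2 hI3 hI4

end Summit.CriticalPhenomena.SAWScalingLimit.Theorems.BoundaryTP2
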